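import Summits.MatrixMultiplication.OmegaCensus.DominoZ5Z5Cells
import Summits.MatrixMultiplication.OmegaCensus.DominoZ5Z5Part6
import Summits.MatrixMultiplication.OmegaCensus.DominoZ5Z5Part7
import Summits.MatrixMultiplication.OmegaCensus.ThreeSetZ4Z4Cells
import Summits.MatrixMultiplication.OmegaCensus.DihedralLawModOneOrder25
import Summits.MatrixMultiplication.OmegaCensus.DihedralLawModOneZ5Z5OrdersArith
import HarnessLib

/-!
# The `|A| ≡ 1 (mod 3)` law over `A ↠ ℤ₅ × ℤ₅` with small element orders: `|A| = 100, 400, 550, 775`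

ω-census `pub-omega`, family (b3), seat pub-omega-group gen 38.  Framing: lottery ticket; floor = certified bounds/negative ranges.
VALUE: kernel theorems for four census lines of the classification of dihedral-like groups attaining `3|S||T||U| + 8 = 8|A|`
('law ⟹ an element of order `≥ |A|/2`'), assembled from existing kernel cells (domino cells over `ℤ₅²`, gens 16–24) and the structure
theorems (non-cube / two parts `1` / a part `2` ⇒ an element of order `≥ |A|/2`) — the `ℤ₅²` analogue of the `ℤ₄²` family
`DihedralLawModOneZ4Z4*.lean`; no new computation; NOT progress on ω.
* `no_mod_one_law_card_100/400/550/775_of_onto_z5z5` — `A` of that order, every element of order `< |A|/2`, `Φ : A ↠ ℤ₅²`;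
  instances in `DihedralLawModOneZ5Z5OrdersInstances.lean` (`ℤ₁₀²`, `ℤ₅ × ℤ₂₀`; `ℤ₅ × ℤ₈₀`, `ℤ₁₀ × ℤ₄₀`; `ℤ₅ × ℤ₁₁₀`; `ℤ₅ × ℤ₁₅₅`).
  With the `ℤ₄²`-quotient and `2`-rank-`≥ 3` families already in the tree, the order-`400` line is thereby complete
  (`ℤ₁₆ × ℤ₅²`, `ℤ₂ × ℤ₈ × ℤ₅²` were the two groups not covered before).
-/

namespace Summit.MatrixMultiplication.OmegaCensus

open Literature.Combinatorics.Additive Finset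

section DihedralLike

variable {A : Type} [AddCommGroup A] [DecidableEq A] [Fintype A] {G : Type} [Group G] [DecidableEq G]
  {ρ τ : A → G} {c₀ : A} {S T U : Finset G}

/-- **No law over `A` of order `100` with all element orders `< |A|/2` and `A ↠ ℤ₅²`** (any presentation constant `c₀`):
cube shapes `stu = 33` — `(1,1,33)`, `(1,3,11)`: two parts `1`, or the cell `(1,3,11)` (`no_law_cube_1de_of_onto_z5z5`). [folklore] -/
theorem no_mod_one_law_card_100_of_onto_z5z5 (hA : Fintype.card A = 100) (hord : ∀ g : A, 2 * addOrderOf g < Fintype.card A)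
    (hρρ : ∀ a b, ρ a * ρ b = ρ (a + b)) (hρτ : ∀ a b, ρ a * τ b = τ (b - a))
    (hτρ : ∀ a b, τ a * ρ b = τ (a + b)) (hττ : ∀ a b, τ a * τ b = ρ (c₀ + b - a))
    (hρ : Function.Injective ρ) (hτ : Function.Injective τ) (hne : ∀ a b, ρ a ≠ τ b)
    (hsurj : ∀ g, (∃ a, ρ a = g) ∨ (∃ a, τ a = g))
    (Φ : A →+ ZMod 5 × ZMod 5) (hΦ : Function.Surjective Φ) (h : TripleProductProperty S T U) :
    3 * (S.card * T.card * U.card) + 8 ≠ 8 * Fintype.card A := by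
  intro hV
  have big : ¬ ∃ g : A, Fintype.card A ≤ 2 * addOrderOf g := by
    rintro ⟨g, hg⟩; exact absurd (hord g) (not_lt.2 hg)
  have hmod : Fintype.card A % 3 = 1 := by rw [hA]
  have hA14 : 14 ≤ Fintype.card A := by rw [hA]; norm_num
  have hA7 : 7 ≤ Fintype.card A := by omega
  have hV_TUS : 3 * (T.card * U.card * S.card) + 8 = 8 * Fintype.card A := by
    rw [show T.card * U.card * S.card = S.card * T.card * U.card by ring]; exact hV
  have hV_UST : 3 * (U.card * S.card * T.card) + 8 = 8 * Fintype.card A := by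
    rw [show U.card * S.card * T.card = S.card * T.card * U.card by ring]; exact hV
  have hTUS : TripleProductProperty T U S := h.rotate
  have hUST : TripleProductProperty U S T := h.rotate.rotate
  by_cases hnc : ((univ.filter fun a : A => ρ a ∈ S).card = (univ.filter fun a : A => τ a ∈ S).card ∧
      (univ.filter fun a : A => ρ a ∈ T).card = (univ.filter fun a : A => τ a ∈ T).card ∧
      (univ.filter fun a : A => ρ a ∈ U).card = (univ.filter fun a : A => τ a ∈ U).card)
  · obtain ⟨hS', hT', hU'⟩ := hnc
    have cS := card_eq_parts' hρ hτ hne hsurj S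
    have cT := card_eq_parts' hρ hτ hne hsurj T
    have cU := card_eq_parts' hρ hτ hne hsurj U
    set s₀ := (univ.filter fun a : A => ρ a ∈ S).card with hs₀
    set t₀ := (univ.filter fun a : A => ρ a ∈ T).card with ht₀
    set u₀ := (univ.filter fun a : A => ρ a ∈ U).card with hu₀
    have eS : S.card = 2 * s₀ := by rw [cS, ← hS']; ring
    have eT : T.card = 2 * t₀ := by rw [cT, ← hT']; ring
    have eU : U.card = 2 * u₀ := by rw [cU, ← hU']; ring
    have hprod : 3 * (s₀ * t₀ * u₀) + 1 = 100 := by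
      rw [eS, eT, eU, hA] at hV; nlinarith
    rcases cube_factor_of_100 hprod with ⟨h1, h2, h3⟩ | ⟨h1, h2, h3⟩ | ⟨h1, h2, h3⟩ | ⟨h1, h2, h3⟩ | ⟨h1, h2, h3⟩ | ⟨h1, h2, h3⟩ | ⟨h1, h2, h3⟩ | ⟨h1, h2, h3⟩ | ⟨h1, h2, h3⟩
    · -- (1,1,33)
      exact big (card_le_two_mul_addOrderOf_of_two_two_law hρρ hρτ hτρ hττ hρ hτ hne hsurj hmod hA7 h (by rw [eS, h1]) (by rw [eT, h2]) hV)
    · -- (1,3,11)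
      exact absurd hV (no_law_cube_two_parts_of_ordered 1 3 (fun h' hS₀ hS₁ hT₀ hT₁ hU'' hV'' => no_law_cube_1de_of_onto_z5z5 (Or.inl rfl) hρρ hρτ hτρ hττ hρ hτ hne hsurj Φ hΦ h' hS₀ hS₁ hT₀ hT₁ hU'' hV'') h hS' hT' hU'
        (Or.inl ⟨h1, h2⟩))
    · -- (1,11,3)
      exact absurd hV (no_law_cube_two_parts_of_ordered 1 3 (fun h' hS₀ hS₁ hT₀ hT₁ hU'' hV'' => no_law_cube_1de_of_onto_z5z5 (Or.inl rfl) hρρ hρτ hτρ hττ hρ hτ hne hsurj Φ hΦ h' hS₀ hS₁ hT₀ hT₁ hU'' hV'') h hS' hT' hU'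
        (Or.inr (Or.inr (Or.inr (Or.inr (Or.inr (⟨h3, h1⟩)))))))
    · -- (1,33,1)
      exact big (card_le_two_mul_addOrderOf_of_two_two_law hρρ hρτ hτρ hττ hρ hτ hne hsurj hmod hA7 hUST (by rw [eU, h3]) (by rw [eS, h1]) hV_UST)
    · -- (3,1,11)
      exact absurd hV (no_law_cube_two_parts_of_ordered 1 3 (fun h' hS₀ hS₁ hT₀ hT₁ hU'' hV'' => no_law_cube_1de_of_onto_z5z5 (Or.inl rfl) hρρ hρτ hτρ hττ hρ hτ hne hsurj Φ hΦ h' hS₀ hS₁ hT₀ hT₁ hU'' hV'') h hS' hT' hU'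
        (Or.inr (Or.inr (Or.inr (Or.inl ⟨h1, h2⟩)))))
    · -- (3,11,1)
      exact absurd hV (no_law_cube_two_parts_of_ordered 1 3 (fun h' hS₀ hS₁ hT₀ hT₁ hU'' hV'' => no_law_cube_1de_of_onto_z5z5 (Or.inl rfl) hρρ hρτ hτρ hττ hρ hτ hne hsurj Φ hΦ h' hS₀ hS₁ hT₀ hT₁ hU'' hV'') h hS' hT' hU'
        (Or.inr (Or.inr (Or.inl ⟨h3, h1⟩))))
    · -- (11,1,3)
      exact absurd hV (no_law_cube_two_parts_of_ordered 1 3 (fun h' hS₀ hS₁ hT₀ hT₁ hU'' hV'' => no_law_cube_1de_of_onto_z5z5 (Or.inl rfl) hρρ hρτ hτρ hττ hρ hτ hne hsurj Φ hΦ h' hS₀ hS₁ hT₀ hT₁ hU'' hV'') h hS' hT' hU'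
        (Or.inr (Or.inl ⟨h2, h3⟩)))
    · -- (11,3,1)
      exact absurd hV (no_law_cube_two_parts_of_ordered 1 3 (fun h' hS₀ hS₁ hT₀ hT₁ hU'' hV'' => no_law_cube_1de_of_onto_z5z5 (Or.inl rfl) hρρ hρτ hτρ hττ hρ hτ hne hsurj Φ hΦ h' hS₀ hS₁ hT₀ hT₁ hU'' hV'') h hS' hT' hU'
        (Or.inr (Or.inr (Or.inr (Or.inr (Or.inl ⟨h2, h3⟩))))))
    · -- (33,1,1)
      exact big (card_le_two_mul_addOrderOf_of_two_two_law hρρ hρτ hτρ hττ hρ hτ hne hsurj hmod hA7 hTUS (by rw [eT, h2]) (by rw [eU, h3]) hV_TUS)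
  · obtain ⟨g, a, b, hab⟩ :=
      two_cosets_of_mod_one_law_of_not_cube hρρ hρτ hτρ hττ hρ hτ hne hsurj hmod hA14 h hV hnc
    exact big ⟨g, card_le_two_mul_addOrderOf_of_two_cosets hab⟩

/-- **No law over `A` of order `400` with all element orders `< |A|/2` and `A ↠ ℤ₅²`** (any presentation constant `c₀`):
cube shapes `stu = 133` — `(1,1,133)`, `(1,7,19)`: two parts `1`, or the cell `(1,7,19)` (`no_law_cube_17e_of_onto_z5z5`). [folklore] -/
theorem no_mod_one_law_card_400_of_onto_z5z5 (hA : Fintype.card A = 400) (hord : ∀ g : A, 2 * addOrderOf g < Fintype.card A)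
    (hρρ : ∀ a b, ρ a * ρ b = ρ (a + b)) (hρτ : ∀ a b, ρ a * τ b = τ (b - a))
    (hτρ : ∀ a b, τ a * ρ b = τ (a + b)) (hττ : ∀ a b, τ a * τ b = ρ (c₀ + b - a))
    (hρ : Function.Injective ρ) (hτ : Function.Injective τ) (hne : ∀ a b, ρ a ≠ τ b)
    (hsurj : ∀ g, (∃ a, ρ a = g) ∨ (∃ a, τ a = g))
    (Φ : A →+ ZMod 5 × ZMod 5) (hΦ : Function.Surjective Φ) (h : TripleProductProperty S T U) :
    3 * (S.card * T.card * U.card) + 8 ≠ 8 * Fintype.card A := by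
  intro hV
  have big : ¬ ∃ g : A, Fintype.card A ≤ 2 * addOrderOf g := by
    rintro ⟨g, hg⟩; exact absurd (hord g) (not_lt.2 hg)
  have hmod : Fintype.card A % 3 = 1 := by rw [hA]
  have hA14 : 14 ≤ Fintype.card A := by rw [hA]; norm_num
  have hA7 : 7 ≤ Fintype.card A := by omega
  have hV_TUS : 3 * (T.card * U.card * S.card) + 8 = 8 * Fintype.card A := by
    rw [show T.card * U.card * S.card = S.card * T.card * U.card by ring]; exact hV
  have hV_UST : 3 * (U.card * S.card * T.card) + 8 = 8 * Fintype.card A := by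
    rw [show U.card * S.card * T.card = S.card * T.card * U.card by ring]; exact hV
  have hTUS : TripleProductProperty T U S := h.rotate
  have hUST : TripleProductProperty U S T := h.rotate.rotate
  by_cases hnc : ((univ.filter fun a : A => ρ a ∈ S).card = (univ.filter fun a : A => τ a ∈ S).card ∧
      (univ.filter fun a : A => ρ a ∈ T).card = (univ.filter fun a : A => τ a ∈ T).card ∧
      (univ.filter fun a : A => ρ a ∈ U).card = (univ.filter fun a : A => τ a ∈ U).card)
  · obtain ⟨hS', hT', hU'⟩ := hnc
    have cS := card_eq_parts' hρ hτ hne hsurj S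
    have cT := card_eq_parts' hρ hτ hne hsurj T
    have cU := card_eq_parts' hρ hτ hne hsurj U
    set s₀ := (univ.filter fun a : A => ρ a ∈ S).card with hs₀
    set t₀ := (univ.filter fun a : A => ρ a ∈ T).card with ht₀
    set u₀ := (univ.filter fun a : A => ρ a ∈ U).card with hu₀
    have eS : S.card = 2 * s₀ := by rw [cS, ← hS']; ring
    have eT : T.card = 2 * t₀ := by rw [cT, ← hT']; ring
    have eU : U.card = 2 * u₀ := by rw [cU, ← hU']; ring
    have hprod : 3 * (s₀ * t₀ * u₀) + 1 = 400 := by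
      rw [eS, eT, eU, hA] at hV; nlinarith
    rcases cube_factor_of_400 hprod with ⟨h1, h2, h3⟩ | ⟨h1, h2, h3⟩ | ⟨h1, h2, h3⟩ | ⟨h1, h2, h3⟩ | ⟨h1, h2, h3⟩ | ⟨h1, h2, h3⟩ | ⟨h1, h2, h3⟩ | ⟨h1, h2, h3⟩ | ⟨h1, h2, h3⟩
    · -- (1,1,133)
      exact big (card_le_two_mul_addOrderOf_of_two_two_law hρρ hρτ hτρ hττ hρ hτ hne hsurj hmod hA7 h (by rw [eS, h1]) (by rw [eT, h2]) hV)
    · -- (1,7,19)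
      exact absurd hV (no_law_cube_two_parts_of_ordered 1 7 (fun h' hS₀ hS₁ hT₀ hT₁ hU'' hV'' => no_law_cube_17e_of_onto_z5z5 hρρ hρτ hτρ hττ hρ hτ hne hsurj Φ hΦ h' hS₀ hS₁ hT₀ hT₁ hU'' hV'') h hS' hT' hU'
        (Or.inl ⟨h1, h2⟩))
    · -- (1,19,7)
      exact absurd hV (no_law_cube_two_parts_of_ordered 1 7 (fun h' hS₀ hS₁ hT₀ hT₁ hU'' hV'' => no_law_cube_17e_of_onto_z5z5 hρρ hρτ hτρ hττ hρ hτ hne hsurj Φ hΦ h' hS₀ hS₁ hT₀ hT₁ hU'' hV'') h hS' hT' hU'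
        (Or.inr (Or.inr (Or.inr (Or.inr (Or.inr (⟨h3, h1⟩)))))))
    · -- (1,133,1)
      exact big (card_le_two_mul_addOrderOf_of_two_two_law hρρ hρτ hτρ hττ hρ hτ hne hsurj hmod hA7 hUST (by rw [eU, h3]) (by rw [eS, h1]) hV_UST)
    · -- (7,1,19)
      exact absurd hV (no_law_cube_two_parts_of_ordered 1 7 (fun h' hS₀ hS₁ hT₀ hT₁ hU'' hV'' => no_law_cube_17e_of_onto_z5z5 hρρ hρτ hτρ hττ hρ hτ hne hsurj Φ hΦ h' hS₀ hS₁ hT₀ hT₁ hU'' hV'') h hS' hT' hU'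
        (Or.inr (Or.inr (Or.inr (Or.inl ⟨h1, h2⟩)))))
    · -- (7,19,1)
      exact absurd hV (no_law_cube_two_parts_of_ordered 1 7 (fun h' hS₀ hS₁ hT₀ hT₁ hU'' hV'' => no_law_cube_17e_of_onto_z5z5 hρρ hρτ hτρ hττ hρ hτ hne hsurj Φ hΦ h' hS₀ hS₁ hT₀ hT₁ hU'' hV'') h hS' hT' hU'
        (Or.inr (Or.inr (Or.inl ⟨h3, h1⟩))))
    · -- (19,1,7)
      exact absurd hV (no_law_cube_two_parts_of_ordered 1 7 (fun h' hS₀ hS₁ hT₀ hT₁ hU'' hV'' => no_law_cube_17e_of_onto_z5z5 hρρ hρτ hτρ hττ hρ hτ hne hsurj Φ hΦ h' hS₀ hS₁ hT₀ hT₁ hU'' hV'') h hS' hT' hU'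
        (Or.inr (Or.inl ⟨h2, h3⟩)))
    · -- (19,7,1)
      exact absurd hV (no_law_cube_two_parts_of_ordered 1 7 (fun h' hS₀ hS₁ hT₀ hT₁ hU'' hV'' => no_law_cube_17e_of_onto_z5z5 hρρ hρτ hτρ hττ hρ hτ hne hsurj Φ hΦ h' hS₀ hS₁ hT₀ hT₁ hU'' hV'') h hS' hT' hU'
        (Or.inr (Or.inr (Or.inr (Or.inr (Or.inl ⟨h2, h3⟩))))))
    · -- (133,1,1)
      exact big (card_le_two_mul_addOrderOf_of_two_two_law hρρ hρτ hτρ hττ hρ hτ hne hsurj hmod hA7 hTUS (by rw [eT, h2]) (by rw [eU, h3]) hV_TUS)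
  · obtain ⟨g, a, b, hab⟩ :=
      two_cosets_of_mod_one_law_of_not_cube hρρ hρτ hτρ hττ hρ hτ hne hsurj hmod hA14 h hV hnc
    exact big ⟨g, card_le_two_mul_addOrderOf_of_two_cosets hab⟩

/-- **No law over `A` of order `550` with all element orders `< |A|/2` and `A ↠ ℤ₅²`** (any presentation constant `c₀`):
cube shapes `stu = 183` — `(1,1,183)`, `(1,3,61)`: two parts `1`, or the cell `(1,3,61)` (`no_law_cube_1de_of_onto_z5z5`). [folklore] -/
theorem no_mod_one_law_card_550_of_onto_z5z5 (hA : Fintype.card A = 550) (hord : ∀ g : A, 2 * addOrderOf g < Fintype.card A)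
    (hρρ : ∀ a b, ρ a * ρ b = ρ (a + b)) (hρτ : ∀ a b, ρ a * τ b = τ (b - a))
    (hτρ : ∀ a b, τ a * ρ b = τ (a + b)) (hττ : ∀ a b, τ a * τ b = ρ (c₀ + b - a))
    (hρ : Function.Injective ρ) (hτ : Function.Injective τ) (hne : ∀ a b, ρ a ≠ τ b)
    (hsurj : ∀ g, (∃ a, ρ a = g) ∨ (∃ a, τ a = g))
    (Φ : A →+ ZMod 5 × ZMod 5) (hΦ : Function.Surjective Φ) (h : TripleProductProperty S T U) :
    3 * (S.card * T.card * U.card) + 8 ≠ 8 * Fintype.card A := by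
  intro hV
  have big : ¬ ∃ g : A, Fintype.card A ≤ 2 * addOrderOf g := by
    rintro ⟨g, hg⟩; exact absurd (hord g) (not_lt.2 hg)
  have hmod : Fintype.card A % 3 = 1 := by rw [hA]
  have hA14 : 14 ≤ Fintype.card A := by rw [hA]; norm_num
  have hA7 : 7 ≤ Fintype.card A := by omega
  have hV_TUS : 3 * (T.card * U.card * S.card) + 8 = 8 * Fintype.card A := by
    rw [show T.card * U.card * S.card = S.card * T.card * U.card by ring]; exact hV
  have hV_UST : 3 * (U.card * S.card * T.card) + 8 = 8 * Fintype.card A := by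
    rw [show U.card * S.card * T.card = S.card * T.card * U.card by ring]; exact hV
  have hTUS : TripleProductProperty T U S := h.rotate
  have hUST : TripleProductProperty U S T := h.rotate.rotate
  by_cases hnc : ((univ.filter fun a : A => ρ a ∈ S).card = (univ.filter fun a : A => τ a ∈ S).card ∧
      (univ.filter fun a : A => ρ a ∈ T).card = (univ.filter fun a : A => τ a ∈ T).card ∧
      (univ.filter fun a : A => ρ a ∈ U).card = (univ.filter fun a : A => τ a ∈ U).card)
  · obtain ⟨hS', hT', hU'⟩ := hnc
    have cS := card_eq_parts' hρ hτ hne hsurj S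
    have cT := card_eq_parts' hρ hτ hne hsurj T
    have cU := card_eq_parts' hρ hτ hne hsurj U
    set s₀ := (univ.filter fun a : A => ρ a ∈ S).card with hs₀
    set t₀ := (univ.filter fun a : A => ρ a ∈ T).card with ht₀
    set u₀ := (univ.filter fun a : A => ρ a ∈ U).card with hu₀
    have eS : S.card = 2 * s₀ := by rw [cS, ← hS']; ring
    have eT : T.card = 2 * t₀ := by rw [cT, ← hT']; ring
    have eU : U.card = 2 * u₀ := by rw [cU, ← hU']; ring
    have hprod : 3 * (s₀ * t₀ * u₀) + 1 = 550 := by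
      rw [eS, eT, eU, hA] at hV; nlinarith
    rcases cube_factor_of_550 hprod with ⟨h1, h2, h3⟩ | ⟨h1, h2, h3⟩ | ⟨h1, h2, h3⟩ | ⟨h1, h2, h3⟩ | ⟨h1, h2, h3⟩ | ⟨h1, h2, h3⟩ | ⟨h1, h2, h3⟩ | ⟨h1, h2, h3⟩ | ⟨h1, h2, h3⟩
    · -- (1,1,183)
      exact big (card_le_two_mul_addOrderOf_of_two_two_law hρρ hρτ hτρ hττ hρ hτ hne hsurj hmod hA7 h (by rw [eS, h1]) (by rw [eT, h2]) hV)
    · -- (1,3,61)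
      exact absurd hV (no_law_cube_two_parts_of_ordered 1 3 (fun h' hS₀ hS₁ hT₀ hT₁ hU'' hV'' => no_law_cube_1de_of_onto_z5z5 (Or.inl rfl) hρρ hρτ hτρ hττ hρ hτ hne hsurj Φ hΦ h' hS₀ hS₁ hT₀ hT₁ hU'' hV'') h hS' hT' hU'
        (Or.inl ⟨h1, h2⟩))
    · -- (1,61,3)
      exact absurd hV (no_law_cube_two_parts_of_ordered 1 3 (fun h' hS₀ hS₁ hT₀ hT₁ hU'' hV'' => no_law_cube_1de_of_onto_z5z5 (Or.inl rfl) hρρ hρτ hτρ hττ hρ hτ hne hsurj Φ hΦ h' hS₀ hS₁ hT₀ hT₁ hU'' hV'') h hS' hT' hU'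
        (Or.inr (Or.inr (Or.inr (Or.inr (Or.inr (⟨h3, h1⟩)))))))
    · -- (1,183,1)
      exact big (card_le_two_mul_addOrderOf_of_two_two_law hρρ hρτ hτρ hττ hρ hτ hne hsurj hmod hA7 hUST (by rw [eU, h3]) (by rw [eS, h1]) hV_UST)
    · -- (3,1,61)
      exact absurd hV (no_law_cube_two_parts_of_ordered 1 3 (fun h' hS₀ hS₁ hT₀ hT₁ hU'' hV'' => no_law_cube_1de_of_onto_z5z5 (Or.inl rfl) hρρ hρτ hτρ hττ hρ hτ hne hsurj Φ hΦ h' hS₀ hS₁ hT₀ hT₁ hU'' hV'') h hS' hT' hU'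
        (Or.inr (Or.inr (Or.inr (Or.inl ⟨h1, h2⟩)))))
    · -- (3,61,1)
      exact absurd hV (no_law_cube_two_parts_of_ordered 1 3 (fun h' hS₀ hS₁ hT₀ hT₁ hU'' hV'' => no_law_cube_1de_of_onto_z5z5 (Or.inl rfl) hρρ hρτ hτρ hττ hρ hτ hne hsurj Φ hΦ h' hS₀ hS₁ hT₀ hT₁ hU'' hV'') h hS' hT' hU'
        (Or.inr (Or.inr (Or.inl ⟨h3, h1⟩))))
    · -- (61,1,3)
      exact absurd hV (no_law_cube_two_parts_of_ordered 1 3 (fun h' hS₀ hS₁ hT₀ hT₁ hU'' hV'' => no_law_cube_1de_of_onto_z5z5 (Or.inl rfl) hρρ hρτ hτρ hττ hρ hτ hne hsurj Φ hΦ h' hS₀ hS₁ hT₀ hT₁ hU'' hV'') h hS' hT' hU'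
        (Or.inr (Or.inl ⟨h2, h3⟩)))
    · -- (61,3,1)
      exact absurd hV (no_law_cube_two_parts_of_ordered 1 3 (fun h' hS₀ hS₁ hT₀ hT₁ hU'' hV'' => no_law_cube_1de_of_onto_z5z5 (Or.inl rfl) hρρ hρτ hτρ hττ hρ hτ hne hsurj Φ hΦ h' hS₀ hS₁ hT₀ hT₁ hU'' hV'') h hS' hT' hU'
        (Or.inr (Or.inr (Or.inr (Or.inr (Or.inl ⟨h2, h3⟩))))))
    · -- (183,1,1)
      exact big (card_le_two_mul_addOrderOf_of_two_two_law hρρ hρτ hτρ hττ hρ hτ hne hsurj hmod hA7 hTUS (by rw [eT, h2]) (by rw [eU, h3]) hV_TUS)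
  · obtain ⟨g, a, b, hab⟩ :=
      two_cosets_of_mod_one_law_of_not_cube hρρ hρτ hτρ hττ hρ hτ hne hsurj hmod hA14 h hV hnc
    exact big ⟨g, card_le_two_mul_addOrderOf_of_two_cosets hab⟩

/-- **No law over `A` of order `775` with all element orders `< |A|/2` and `A ↠ ℤ₅²`** (any presentation constant `c₀`):
cube shapes `stu = 258` — `(1,1,258)`, `(1,2,129)`, `(1,3,86)`, `(1,6,43)`, `(2,3,43)`: two parts `1`, a part `2`, or the cells `(1,3,86)`, `(1,6,43)` (`no_law_cube_1de/1de6_of_onto_z5z5`). [folklore] -/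
theorem no_mod_one_law_card_775_of_onto_z5z5 (hA : Fintype.card A = 775) (hord : ∀ g : A, 2 * addOrderOf g < Fintype.card A)
    (hρρ : ∀ a b, ρ a * ρ b = ρ (a + b)) (hρτ : ∀ a b, ρ a * τ b = τ (b - a))
    (hτρ : ∀ a b, τ a * ρ b = τ (a + b)) (hττ : ∀ a b, τ a * τ b = ρ (c₀ + b - a))
    (hρ : Function.Injective ρ) (hτ : Function.Injective τ) (hne : ∀ a b, ρ a ≠ τ b)
    (hsurj : ∀ g, (∃ a, ρ a = g) ∨ (∃ a, τ a = g))
    (Φ : A →+ ZMod 5 × ZMod 5) (hΦ : Function.Surjective Φ) (h : TripleProductProperty S T U) :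
    3 * (S.card * T.card * U.card) + 8 ≠ 8 * Fintype.card A := by
  intro hV
  have big : ¬ ∃ g : A, Fintype.card A ≤ 2 * addOrderOf g := by
    rintro ⟨g, hg⟩; exact absurd (hord g) (not_lt.2 hg)
  have hmod : Fintype.card A % 3 = 1 := by rw [hA]
  have hA14 : 14 ≤ Fintype.card A := by rw [hA]; norm_num
  have hA7 : 7 ≤ Fintype.card A := by omega
  have hV_TUS : 3 * (T.card * U.card * S.card) + 8 = 8 * Fintype.card A := by
    rw [show T.card * U.card * S.card = S.card * T.card * U.card by ring]; exact hV
  have hV_UST : 3 * (U.card * S.card * T.card) + 8 = 8 * Fintype.card A := by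
    rw [show U.card * S.card * T.card = S.card * T.card * U.card by ring]; exact hV
  have hTUS : TripleProductProperty T U S := h.rotate
  have hUST : TripleProductProperty U S T := h.rotate.rotate
  by_cases hnc : ((univ.filter fun a : A => ρ a ∈ S).card = (univ.filter fun a : A => τ a ∈ S).card ∧
      (univ.filter fun a : A => ρ a ∈ T).card = (univ.filter fun a : A => τ a ∈ T).card ∧
      (univ.filter fun a : A => ρ a ∈ U).card = (univ.filter fun a : A => τ a ∈ U).card)
  · obtain ⟨hS', hT', hU'⟩ := hnc
    have cS := card_eq_parts' hρ hτ hne hsurj S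
    have cT := card_eq_parts' hρ hτ hne hsurj T
    have cU := card_eq_parts' hρ hτ hne hsurj U
    set s₀ := (univ.filter fun a : A => ρ a ∈ S).card with hs₀
    set t₀ := (univ.filter fun a : A => ρ a ∈ T).card with ht₀
    set u₀ := (univ.filter fun a : A => ρ a ∈ U).card with hu₀
    have eS : S.card = 2 * s₀ := by rw [cS, ← hS']; ring
    have eT : T.card = 2 * t₀ := by rw [cT, ← hT']; ring
    have eU : U.card = 2 * u₀ := by rw [cU, ← hU']; ring
    have hprod : 3 * (s₀ * t₀ * u₀) + 1 = 775 := by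
      rw [eS, eT, eU, hA] at hV; nlinarith
    rcases cube_factor_of_775 hprod with ⟨h1, h2, h3⟩ | ⟨h1, h2, h3⟩ | ⟨h1, h2, h3⟩ | ⟨h1, h2, h3⟩ | ⟨h1, h2, h3⟩ | ⟨h1, h2, h3⟩ | ⟨h1, h2, h3⟩ | ⟨h1, h2, h3⟩ | ⟨h1, h2, h3⟩ | ⟨h1, h2, h3⟩ | ⟨h1, h2, h3⟩ | ⟨h1, h2, h3⟩ | ⟨h1, h2, h3⟩ | ⟨h1, h2, h3⟩ | ⟨h1, h2, h3⟩ | ⟨h1, h2, h3⟩ | ⟨h1, h2, h3⟩ | ⟨h1, h2, h3⟩ | ⟨h1, h2, h3⟩ | ⟨h1, h2, h3⟩ | ⟨h1, h2, h3⟩ | ⟨h1, h2, h3⟩ | ⟨h1, h2, h3⟩ | ⟨h1, h2, h3⟩ | ⟨h1, h2, h3⟩ | ⟨h1, h2, h3⟩ | ⟨h1, h2, h3⟩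
    · -- (1,1,258)
      exact big (card_le_two_mul_addOrderOf_of_two_two_law hρρ hρτ hτρ hττ hρ hτ hne hsurj hmod hA7 h (by rw [eS, h1]) (by rw [eT, h2]) hV)
    · -- (1,2,129)
      exact big (card_le_two_mul_addOrderOf_of_mod_one_law_card_four hρρ hρτ hτρ hττ hρ hτ hne hsurj hmod hA14 h hV (by rw [eT, h2]))
    · -- (1,3,86)
      exact absurd hV (no_law_cube_two_parts_of_ordered 1 3 (fun h' hS₀ hS₁ hT₀ hT₁ hU'' hV'' => no_law_cube_1de_of_onto_z5z5 (Or.inl rfl) hρρ hρτ hτρ hττ hρ hτ hne hsurj Φ hΦ h' hS₀ hS₁ hT₀ hT₁ hU'' hV'') h hS' hT' hU'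
        (Or.inl ⟨h1, h2⟩))
    · -- (1,6,43)
      exact absurd hV (no_law_cube_two_parts_of_ordered 1 6 (fun h' hS₀ hS₁ hT₀ hT₁ hU'' hV'' => no_law_cube_1de6_of_onto_z5z5 rfl hρρ hρτ hτρ hττ hρ hτ hne hsurj Φ hΦ h' hS₀ hS₁ hT₀ hT₁ hU'' hV'') h hS' hT' hU'
        (Or.inl ⟨h1, h2⟩))
    · -- (1,43,6)
      exact absurd hV (no_law_cube_two_parts_of_ordered 1 6 (fun h' hS₀ hS₁ hT₀ hT₁ hU'' hV'' => no_law_cube_1de6_of_onto_z5z5 rfl hρρ hρτ hτρ hττ hρ hτ hne hsurj Φ hΦ h' hS₀ hS₁ hT₀ hT₁ hU'' hV'') h hS' hT' hU'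
        (Or.inr (Or.inr (Or.inr (Or.inr (Or.inr (⟨h3, h1⟩)))))))
    · -- (1,86,3)
      exact absurd hV (no_law_cube_two_parts_of_ordered 1 3 (fun h' hS₀ hS₁ hT₀ hT₁ hU'' hV'' => no_law_cube_1de_of_onto_z5z5 (Or.inl rfl) hρρ hρτ hτρ hττ hρ hτ hne hsurj Φ hΦ h' hS₀ hS₁ hT₀ hT₁ hU'' hV'') h hS' hT' hU'
        (Or.inr (Or.inr (Or.inr (Or.inr (Or.inr (⟨h3, h1⟩)))))))
    · -- (1,129,2)
      exact big (card_le_two_mul_addOrderOf_of_mod_one_law_card_four hρρ hρτ hτρ hττ hρ hτ hne hsurj hmod hA14 hTUS hV_TUS (by rw [eU, h3]))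
    · -- (1,258,1)
      exact big (card_le_two_mul_addOrderOf_of_two_two_law hρρ hρτ hτρ hττ hρ hτ hne hsurj hmod hA7 hUST (by rw [eU, h3]) (by rw [eS, h1]) hV_UST)
    · -- (2,1,129)
      exact big (card_le_two_mul_addOrderOf_of_mod_one_law_card_four hρρ hρτ hτρ hττ hρ hτ hne hsurj hmod hA14 hUST hV_UST (by rw [eS, h1]))
    · -- (2,3,43)
      exact big (card_le_two_mul_addOrderOf_of_mod_one_law_card_four hρρ hρτ hτρ hττ hρ hτ hne hsurj hmod hA14 hUST hV_UST (by rw [eS, h1]))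
    · -- (2,43,3)
      exact big (card_le_two_mul_addOrderOf_of_mod_one_law_card_four hρρ hρτ hτρ hττ hρ hτ hne hsurj hmod hA14 hUST hV_UST (by rw [eS, h1]))
    · -- (2,129,1)
      exact big (card_le_two_mul_addOrderOf_of_mod_one_law_card_four hρρ hρτ hτρ hττ hρ hτ hne hsurj hmod hA14 hUST hV_UST (by rw [eS, h1]))
    · -- (3,1,86)
      exact absurd hV (no_law_cube_two_parts_of_ordered 1 3 (fun h' hS₀ hS₁ hT₀ hT₁ hU'' hV'' => no_law_cube_1de_of_onto_z5z5 (Or.inl rfl) hρρ hρτ hτρ hττ hρ hτ hne hsurj Φ hΦ h' hS₀ hS₁ hT₀ hT₁ hU'' hV'') h hS' hT' hU'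
        (Or.inr (Or.inr (Or.inr (Or.inl ⟨h1, h2⟩)))))
    · -- (3,2,43)
      exact big (card_le_two_mul_addOrderOf_of_mod_one_law_card_four hρρ hρτ hτρ hττ hρ hτ hne hsurj hmod hA14 h hV (by rw [eT, h2]))
    · -- (3,43,2)
      exact big (card_le_two_mul_addOrderOf_of_mod_one_law_card_four hρρ hρτ hτρ hττ hρ hτ hne hsurj hmod hA14 hTUS hV_TUS (by rw [eU, h3]))
    · -- (3,86,1)
      exact absurd hV (no_law_cube_two_parts_of_ordered 1 3 (fun h' hS₀ hS₁ hT₀ hT₁ hU'' hV'' => no_law_cube_1de_of_onto_z5z5 (Or.inl rfl) hρρ hρτ hτρ hττ hρ hτ hne hsurj Φ hΦ h' hS₀ hS₁ hT₀ hT₁ hU'' hV'') h hS' hT' hU'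
        (Or.inr (Or.inr (Or.inl ⟨h3, h1⟩))))
    · -- (6,1,43)
      exact absurd hV (no_law_cube_two_parts_of_ordered 1 6 (fun h' hS₀ hS₁ hT₀ hT₁ hU'' hV'' => no_law_cube_1de6_of_onto_z5z5 rfl hρρ hρτ hτρ hττ hρ hτ hne hsurj Φ hΦ h' hS₀ hS₁ hT₀ hT₁ hU'' hV'') h hS' hT' hU'
        (Or.inr (Or.inr (Or.inr (Or.inl ⟨h1, h2⟩)))))
    · -- (6,43,1)
      exact absurd hV (no_law_cube_two_parts_of_ordered 1 6 (fun h' hS₀ hS₁ hT₀ hT₁ hU'' hV'' => no_law_cube_1de6_of_onto_z5z5 rfl hρρ hρτ hτρ hττ hρ hτ hne hsurj Φ hΦ h' hS₀ hS₁ hT₀ hT₁ hU'' hV'') h hS' hT' hU'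
        (Or.inr (Or.inr (Or.inl ⟨h3, h1⟩))))
    · -- (43,1,6)
      exact absurd hV (no_law_cube_two_parts_of_ordered 1 6 (fun h' hS₀ hS₁ hT₀ hT₁ hU'' hV'' => no_law_cube_1de6_of_onto_z5z5 rfl hρρ hρτ hτρ hττ hρ hτ hne hsurj Φ hΦ h' hS₀ hS₁ hT₀ hT₁ hU'' hV'') h hS' hT' hU'
        (Or.inr (Or.inl ⟨h2, h3⟩)))
    · -- (43,2,3)
      exact big (card_le_two_mul_addOrderOf_of_mod_one_law_card_four hρρ hρτ hτρ hττ hρ hτ hne hsurj hmod hA14 h hV (by rw [eT, h2]))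
    · -- (43,3,2)
      exact big (card_le_two_mul_addOrderOf_of_mod_one_law_card_four hρρ hρτ hτρ hττ hρ hτ hne hsurj hmod hA14 hTUS hV_TUS (by rw [eU, h3]))
    · -- (43,6,1)
      exact absurd hV (no_law_cube_two_parts_of_ordered 1 6 (fun h' hS₀ hS₁ hT₀ hT₁ hU'' hV'' => no_law_cube_1de6_of_onto_z5z5 rfl hρρ hρτ hτρ hττ hρ hτ hne hsurj Φ hΦ h' hS₀ hS₁ hT₀ hT₁ hU'' hV'') h hS' hT' hU'
        (Or.inr (Or.inr (Or.inr (Or.inr (Or.inl ⟨h2, h3⟩))))))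
    · -- (86,1,3)
      exact absurd hV (no_law_cube_two_parts_of_ordered 1 3 (fun h' hS₀ hS₁ hT₀ hT₁ hU'' hV'' => no_law_cube_1de_of_onto_z5z5 (Or.inl rfl) hρρ hρτ hτρ hττ hρ hτ hne hsurj Φ hΦ h' hS₀ hS₁ hT₀ hT₁ hU'' hV'') h hS' hT' hU'
        (Or.inr (Or.inl ⟨h2, h3⟩)))
    · -- (86,3,1)
      exact absurd hV (no_law_cube_two_parts_of_ordered 1 3 (fun h' hS₀ hS₁ hT₀ hT₁ hU'' hV'' => no_law_cube_1de_of_onto_z5z5 (Or.inl rfl) hρρ hρτ hτρ hττ hρ hτ hne hsurj Φ hΦ h' hS₀ hS₁ hT₀ hT₁ hU'' hV'') h hS' hT' hU'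
        (Or.inr (Or.inr (Or.inr (Or.inr (Or.inl ⟨h2, h3⟩))))))
    · -- (129,1,2)
      exact big (card_le_two_mul_addOrderOf_of_mod_one_law_card_four hρρ hρτ hτρ hττ hρ hτ hne hsurj hmod hA14 hTUS hV_TUS (by rw [eU, h3]))
    · -- (129,2,1)
      exact big (card_le_two_mul_addOrderOf_of_mod_one_law_card_four hρρ hρτ hτρ hττ hρ hτ hne hsurj hmod hA14 h hV (by rw [eT, h2]))
    · -- (258,1,1)
      exact big (card_le_two_mul_addOrderOf_of_two_two_law hρρ hρτ hτρ hττ hρ hτ hne hsurj hmod hA7 hTUS (by rw [eT, h2]) (by rw [eU, h3]) hV_TUS)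
  · obtain ⟨g, a, b, hab⟩ :=
      two_cosets_of_mod_one_law_of_not_cube hρρ hρτ hτρ hττ hρ hτ hne hsurj hmod hA14 h hV hnc
    exact big ⟨g, card_le_two_mul_addOrderOf_of_two_cosets hab⟩

end DihedralLike

end Summit.MatrixMultiplication.OmegaCensus
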